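import Literature.NumberTheory.ComplexMultiplication.EllipticUnits.KatoLayerRamification
import Mathlib.RingTheory.RootsOfUnity.AlgebraicallyClosed
import HarnessLib

/-!
# The twelfth-root slack in Kato's layers `K(p^s𝔣)`: `ζ^{12} = 1, ζ ∈ K(p^s𝔣), s ≥ k+2 ⇒ ζ ∈ (K(p^s𝔣)^×)^{p^k}`

Topic `Literature/NumberTheory/ComplexMultiplication/EllipticUnits`, namespace
`Literature.NumberTheory.ComplexMultiplication.EllipticUnits`. Width seat `bsd-line-cf2-p1-w5` g9 (cell
`bsd-print-cf2`), piece (S1′) of the cell's construction F0b (the zeta pins of ty2 g37's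
`JohnsonLeungKings2011.TwistedIwasawaData`); the inclusion `μ_{p^s} ⊂ K(p^s𝔣)` itself is -w2 g17's
`mem_katoLayer_of_pow_eq_one` (`KatoLayerRamification.lean`), imported. Theorems only; no definition, no
named fact, no `instance`, no `sorry`.

* **`exists_pow_eq_of_pow_twelve_eq_one`** — the TWELFTH-ROOT SLACK of Johnson-Leung–Kings / Kato
  (transcription note (T4) of the carriers file): for a totally complex `K`, `𝔣 ≠ 0` and `s ≥ k + 2`, every
  `ζ ∈ K(p^s𝔣)` with `ζ^{12} = 1` is a `p^k`-th power IN `K(p^s𝔣)` — so two Kato representatives `u, ζu` of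
  an elliptic unit (`u^{12} = Θ(1; p^s𝔣, 𝔞)`, de Shalit II.2.4 / Kato §15.5 with reading (R12)) have the
  same twisted Kummer classes at depth `k` (`σ(ηβ)/(ηβ) = σβ/β` for `η ∈ K(p^s𝔣)`, `σ ∈ Gal(K̄/K(p^s𝔣))`).
  Proof: split `ζ` into its `p`-primary part (of order dividing `p²`; a power of a primitive `p^{k+2}`-th
  root of unity, which lies in `K(p^s𝔣)`) and its prime-to-`p` part (a `p^k`-th power of a power of itself).
* `exists_isPrimitiveRoot_mem_katoLayer` — a primitive `p^m`-th root of unity in `K(p^s𝔣)`, `m ≤ s`.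
* `exists_pow_pow_eq_of_pow_eq_one`, `exists_pow_pow_eq_of_isPrimitiveRoot`, `exists_split_of_pow_twelve_eq_one`
  — the elementary torsion lemmas.

## References
* [JohnsonLeungKings2011] J. Johnson-Leung, G. Kings, arXiv:0804.2828, Prop. 3.3 (1) and proof
  (p0009:L85–127: "`_𝔞θ_E` is a twelfth root of the function in Chapter II of [dS]"), Def. 3.5 (p0010:L72–80).
* [Kato2004Asterisque] K. Kato, Astérisque 295, §15.5 (p. 253).
* [NeukirchANT1999] J. Neukirch, *Algebraic Number Theory*, Ch. VI §6 Prop. (6.7).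
* [Washington1997] L. Washington, *Introduction to Cyclotomic Fields*, Lemma 1.3, Prop. 13.2.
-/

noncomputable section

open scoped NumberField
open Field NumberField IsDedekindDomain
open Literature.NumberTheory.NumberFields
open Literature.NumberTheory.GaloisRepresentations
open Literature.NumberTheory.EllipticCurves

namespace Literature.NumberTheory.ComplexMultiplication.EllipticUnits

/-! ## §0 An elementary lemma on torsion elements of a monoid -/

section Elementary

variable {M : Type*} [CommMonoid M]

/-- If `x^m = 1` and `gcd(m, d) = 1` then `x` is a `d`-th power of a power of itself.
[cite: Washington1997, Lemma 1.3 (proof idea)] -/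
theorem exists_pow_pow_eq_of_pow_eq_one {x : M} {m d : ℕ} (hx : x ^ m = 1) (hmd : m.Coprime d) :
    ∃ t : ℕ, (x ^ t) ^ d = x := by
  rcases Nat.lt_or_ge 1 m with hm | hm
  · obtain ⟨t, -, ht⟩ := Nat.exists_mul_mod_eq_one_of_coprime hmd.symm hm
    refine ⟨t, ?_⟩
    rw [← pow_mul, mul_comm, ← Nat.div_add_mod (d * t) m, ht, pow_add, pow_mul, hx, one_pow, one_mul,
      pow_one]
  · interval_cases m
    · rw [Nat.coprime_zero_left] at hmd
      exact ⟨1, by rw [hmd, pow_one, pow_one]⟩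
    · rw [pow_one] at hx
      exact ⟨0, by rw [hx, one_pow, one_pow]⟩

/-- If `ω` is a primitive `a·b`-th root of unity and `x^b = 1`, then `x` is an `a`-th power of a power of `ω`
(`ω^a` is a primitive `b`-th root of unity). [cite: Washington1997, Lemma 1.3 (proof idea)] -/
theorem exists_pow_pow_eq_of_isPrimitiveRoot {R : Type*} [CommRing R] [IsDomain R] {ω x : R} {a b : ℕ}
    (ha : 0 < a) (hb : 0 < b)
    (hω : IsPrimitiveRoot ω (a * b)) (hx : x ^ b = 1) : ∃ j : ℕ, (ω ^ j) ^ a = x := by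
  haveI : NeZero b := ⟨hb.ne'⟩
  obtain ⟨j, -, hj⟩ := (hω.pow (Nat.mul_pos ha hb) rfl).eq_pow_of_pow_eq_one hx
  exact ⟨j, by rw [← pow_mul, mul_comm, pow_mul, hj]⟩

end Elementary

/-! ## §1 A primitive `p^m`-th root of unity in `K(p^s𝔣)` -/

variable {K : Type} [Field K] [NumberField K] (p : ℕ) [Fact p.Prime] (𝔣 : Ideal (𝓞 K))

/-- **A primitive `p^m`-th root of unity inside `K(p^s𝔣)`** for `m ≤ s` (totally complex `K`, `𝔣 ≠ 0`).
[cite: NeukirchANT1999, Ch. VI §6 Prop. (6.7)] [cite: Washington1997, Prop. 13.2] -/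
theorem exists_isPrimitiveRoot_mem_katoLayer [IsTotallyComplex K] (h𝔣 : 𝔣 ≠ ⊥) {m s : ℕ} (hms : m ≤ s) :
    ∃ ω : AlgebraicClosure K, IsPrimitiveRoot ω (p ^ m) ∧ ω ∈ katoLayer p 𝔣 s := by
  have hp : p.Prime := Fact.out
  haveI : NeZero (p ^ m) := ⟨pow_ne_zero _ hp.ne_zero⟩
  obtain ⟨ω, hω⟩ := HasEnoughRootsOfUnity.exists_primitiveRoot (AlgebraicClosure K) (p ^ m)
  refine ⟨ω, hω, mem_katoLayer_of_pow_eq_one p 𝔣 h𝔣 (s := s) ?_⟩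
  obtain ⟨c, hc⟩ := pow_dvd_pow p hms
  rw [hc, pow_mul, hω.pow_eq_one, one_pow]

/-! ## §2 The twelfth-root slack -/

/-- Splitting a twelfth root of unity into a `p²`-torsion part and a prime-to-`p` part: for every prime `p`
there are `m` coprime to `p` and exponents `e₁, e₂` with `ζ = ζ^{e₁}·ζ^{e₂}`, `(ζ^{e₁})^{p²} = 1`,
`(ζ^{e₂})^m = 1` whenever `ζ^{12} = 1`. [cite: Washington1997, Lemma 1.3 (proof idea)] -/
theorem exists_split_of_pow_twelve_eq_one {M : Type*} [CommMonoid M] {ζ : M} (hζ : ζ ^ 12 = 1) :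
    ∃ (m e₁ e₂ : ℕ), 0 < m ∧ m.Coprime p ∧ (ζ ^ e₁) ^ p ^ 2 = 1 ∧ (ζ ^ e₂) ^ m = 1 ∧ ζ ^ e₁ * ζ ^ e₂ = ζ := by
  have hp : p.Prime := Fact.out
  have h13 : ζ ^ 9 * ζ ^ 4 = ζ := by
    rw [← pow_add, show 9 + 4 = 12 + 1 by norm_num, pow_succ, hζ, one_mul]
  have h36a : (ζ ^ 9) ^ 4 = 1 := by
    rw [← pow_mul, show 9 * 4 = 12 * 3 by norm_num, pow_mul, hζ, one_pow]
  have h36b : (ζ ^ 4) ^ 9 = 1 := by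
    rw [← pow_mul, show 4 * 9 = 12 * 3 by norm_num, pow_mul, hζ, one_pow]
  have h12a : (ζ ^ 4) ^ 3 = 1 := by rw [← pow_mul, hζ]
  by_cases hp2 : p = 2
  · subst hp2
    exact ⟨3, 9, 4, by norm_num, by norm_num, by simpa using h36a, h12a, h13⟩
  by_cases hp3 : p = 3
  · subst hp3
    refine ⟨4, 4, 9, by norm_num, by norm_num, by simpa using h36b, h36a, ?_⟩
    rw [mul_comm]; exact h13
  · refine ⟨12, 0, 1, by norm_num, ?_, by rw [pow_zero, one_pow], by rw [pow_one, hζ], by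
      rw [pow_zero, pow_one, one_mul]⟩
    rw [Nat.coprime_comm, hp.coprime_iff_not_dvd]
    intro h
    have hle : p ≤ 12 := Nat.le_of_dvd (by norm_num) h
    interval_cases p <;> simp_all (config := {decide := true})

/-- **The twelfth-root slack** (transcription note (T4) of the carriers file): for a totally complex `K`,
`𝔣 ≠ 0` and `s ≥ k + 2`, every `ζ ∈ K(p^s𝔣)` with `ζ^{12} = 1` is the `p^k`-th power of an element of
`K(p^s𝔣)` — the `p`-primary part of `ζ` is a power of a primitive `p^{k+2}`-th root of unity, which lies in
`K(p^s𝔣)` (`μ_{p^s} ⊂ K(p^s𝔣)`), and the prime-to-`p` part is a `p^k`-th power of a power of itself. Hence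
Kato representatives differing by twelfth roots of unity give the same Kummer classes at depth `k`.
[cite: JohnsonLeungKings2011, Prop. 3.3 (1) and proof (arXiv p0009:L85–127)] [cite: Kato2004Asterisque, §15.5 (p. 253)] -/
theorem exists_pow_eq_of_pow_twelve_eq_one [IsTotallyComplex K] (h𝔣 : 𝔣 ≠ ⊥) {s k : ℕ} (hs : k + 2 ≤ s)
    {ζ : AlgebraicClosure K} (hζF : ζ ∈ katoLayer p 𝔣 s) (hζ : ζ ^ 12 = 1) :
    ∃ η ∈ katoLayer p 𝔣 s, η ^ p ^ k = ζ := by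
  have hp : p.Prime := Fact.out
  obtain ⟨m, e₁, e₂, hm, hmp, h₁, h₂, hsplit⟩ := exists_split_of_pow_twelve_eq_one p hζ
  -- the `p`-primary part: a power of a primitive `p^{k+2}`-th root of unity `ω ∈ K(p^s𝔣)`
  obtain ⟨ω, hω, hωF⟩ := exists_isPrimitiveRoot_mem_katoLayer p 𝔣 h𝔣 hs
  rw [pow_add] at hω
  obtain ⟨j, hj⟩ := exists_pow_pow_eq_of_isPrimitiveRoot (pow_pos hp.pos _) (pow_pos hp.pos _) hω h₁
  -- the prime-to-`p` part
  obtain ⟨t, ht⟩ := exists_pow_pow_eq_of_pow_eq_one h₂ (Nat.Coprime.pow_right k hmp)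
  refine ⟨ω ^ j * (ζ ^ e₂) ^ t, mul_mem (pow_mem hωF j) (pow_mem (pow_mem hζF e₂) t), ?_⟩
  rw [mul_pow, hj, ht, hsplit]

end Literature.NumberTheory.ComplexMultiplication.EllipticUnits

end
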